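import Summits.RiemannHypothesis.RiemannHypothesis.Theorems.Splittings.NbTargetsDilation
import HarnessLib

/-!
# RH-EQUIVALENT·SPLITTING CENSUS (nb, neg) · V39 «TARGETS» (3/3): a target whose Mellin data HAS strip zeros — the two-step target `χ - 2^{3/4}𝟙_(0,1/2]`: RH ⟹ TARGET ⟹ every zero of `ζ` in `1/2 < σ < 1` lies at `σ = 3/4`, `2^s = 2^{3/4}`; the splitting TARGET ∧ «ζ ≠ 0 at those lattice points» ⟹ RH is provable but both conjuncts are RH-implied; nothing here bears on the truth of RH

LABEL (line 1): RH-EQUIVALENT·SPLITTING (cell `rh-split`, seat (nb, neg), generation 14, census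
candidate V39, branch (γ) of the target axis).  Target `f₀ = 𝟙_(0,1] - 2^{3/4}·𝟙_(0,1/2]`, an
element of (the image of) Báez-Duarte's space `D` whose Mellin transform
`(1 - 2^{3/4} 2^{-s})/s` vanishes exactly on the arithmetic progression `s = 3/4 + 2πik/log 2`.

* `mellin_twoStep` : `∫_0^∞ f₀(x)x^{s-1}dx = (1 - 2^{3/4}(1/2)^s)/s` (`Re s > 0`).
* `twoStep_mellin_eq_zero` : a zero `s`, `Re s > 0`, of that transform has `Re s = 3/4` and
  `2^s = 2^{3/4}`.
* `zeros_confined_of_nbTarget_twoStep` (RH-free): TARGET(f₀) ⟹ every zero of `ζ` with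
  `1/2 < Re s < 1` satisfies `Re s = 3/4 ∧ 2^s = 2^{3/4}` (zero CONFINEMENT to an explicit lattice on
  one vertical line — a statement implied by RH and NOT known to imply it).
* `riemannHypothesis_of_nbTarget_twoStep` : FIN(f₀) ∧ TARGET(f₀) ⟹ RH with the thin conjunct
  FIN(f₀) = «`ζ(s) ≠ 0` whenever `Re s = 3/4` and `2^s = 2^{3/4}`» (countably many point conditions;
  every finite truncation is a known zero computation, the whole is RH-implied and open).
* `nbTarget_twoStep_of_rh` : RH ⟹ TARGET(f₀) (two dilates of one Báez-Duarte approximant).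

Hygiene: zero `def`s, no `sorry`, no new axioms, no `instance`/`notation`.
-/

set_option linter.dupNamespace false

noncomputable section

open Complex Filter MeasureTheory Set
open scoped Real Topology ENNReal

namespace Summit.RiemannHypothesis.RiemannHypothesis.Theorems.Splittings.NbTargets

open Literature.NumberTheory.LFunctions

/-- Real-indicator spelling of the complex indicator of `(0,b]`. [folklore] -/
theorem ofReal_indicator_Ioc (b : ℝ) :
    (fun x : ℝ ↦ (((Ioc (0 : ℝ) b).indicator 1 x : ℝ) : ℂ)) =
      (Ioc (0 : ℝ) b).indicator fun _ ↦ (1 : ℂ) := by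
  funext x
  by_cases hxI : x ∈ Ioc (0 : ℝ) b
  · rw [indicator_of_mem hxI, indicator_of_mem hxI, Pi.one_apply, Complex.ofReal_one]
  · rw [indicator_of_notMem hxI, indicator_of_notMem hxI, Complex.ofReal_zero]

/-- Mellin transform of the two-step target:
`∫_0^∞ (𝟙_(0,1] - 2^{3/4}𝟙_(0,1/2])(x) x^{s-1} dx = (1 - 2^{3/4}(1/2)^s)/s` for `Re s > 0`.
[folklore] -/
theorem mellin_twoStep {s : ℂ} (hs : 0 < s.re) :
    mellin (fun x : ℝ ↦ (((Ioc (0 : ℝ) 1).indicator 1 x -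
        (2 : ℝ) ^ ((3 : ℝ) / 4) * (Ioc (0 : ℝ) (1 / 2)).indicator 1 x : ℝ) : ℂ)) s =
      (1 - (((2 : ℝ) ^ ((3 : ℝ) / 4) : ℝ) : ℂ) * (((1 / 2 : ℝ)) : ℂ) ^ s) / s := by
  have hA := hasMellin_indicator_Ioc (c := 1) one_pos hs
  have hB := hasMellin_indicator_Ioc (c := 1 / 2) (by norm_num) hs
  have hBr := hB.1.const_smul ((((2 : ℝ) ^ ((3 : ℝ) / 4) : ℝ) : ℂ))
  have hfun : (fun x : ℝ ↦ (((Ioc (0 : ℝ) 1).indicator 1 x -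
      (2 : ℝ) ^ ((3 : ℝ) / 4) * (Ioc (0 : ℝ) (1 / 2)).indicator 1 x : ℝ) : ℂ)) =
      fun x ↦ (Ioc (0 : ℝ) 1).indicator (fun _ ↦ (1 : ℂ)) x -
        (((2 : ℝ) ^ ((3 : ℝ) / 4) : ℝ) : ℂ) • (Ioc (0 : ℝ) (1 / 2)).indicator (fun _ ↦ (1 : ℂ)) x := by
    funext x
    rw [← congrFun (ofReal_indicator_Ioc 1) x, ← congrFun (ofReal_indicator_Ioc (1 / 2)) x,
      smul_eq_mul]
    push_cast
    ring
  rw [hfun, (hasMellin_sub hA.1 hBr).2, mellin_const_smul, hA.2, hB.2, smul_eq_mul]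
  push_cast
  rw [Complex.one_cpow]
  ring

/-- **Zeros of the two-step Mellin data.**  If `Re s > 0` and `(1 - 2^{3/4}(1/2)^s)/s = 0` then
`Re s = 3/4` and `2^s = 2^{3/4}` (i.e. `s = 3/4 + 2πik/log 2`). [folklore] -/
theorem twoStep_mellin_eq_zero {s : ℂ} (hs : 0 < s.re)
    (h0 : (1 - (((2 : ℝ) ^ ((3 : ℝ) / 4) : ℝ) : ℂ) * (((1 / 2 : ℝ)) : ℂ) ^ s) / s = 0) :
    s.re = 3 / 4 ∧ (2 : ℂ) ^ s = (2 : ℂ) ^ ((3 : ℂ) / 4) := by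
  have hs0 : s ≠ 0 := fun h ↦ by simp [h] at hs
  rw [div_eq_zero_iff, or_iff_left hs0, sub_eq_zero] at h0
  -- `(1/2)^s = (2^s)⁻¹`
  have hhalf : (((1 / 2 : ℝ)) : ℂ) ^ s = ((2 : ℂ) ^ s)⁻¹ := by
    rw [show (((1 / 2 : ℝ)) : ℂ) = (2 : ℂ)⁻¹ by push_cast; ring]
    exact Complex.inv_cpow _ _ (by rw [Complex.ofNat_arg]; exact Real.pi_pos.ne)
  have h2s : (2 : ℂ) ^ s ≠ 0 := by
    rw [Ne, cpow_eq_zero_iff, not_and_or]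
    exact Or.inl two_ne_zero
  rw [hhalf, eq_comm, mul_inv_eq_one₀ h2s] at h0
  -- `h0 : 2^{3/4} = 2^s` (as complex numbers)
  have hr : (((2 : ℝ) ^ ((3 : ℝ) / 4) : ℝ) : ℂ) = (2 : ℂ) ^ ((3 : ℂ) / 4) := by
    rw [Complex.ofReal_cpow (by norm_num : (0 : ℝ) ≤ 2)]
    push_cast
    rfl
  refine ⟨?_, by rw [← h0, hr]⟩
  have hn := congrArg (fun z : ℂ ↦ ‖z‖) h0
  simp only [Complex.norm_real, Real.norm_eq_abs] at hn
  rw [abs_of_pos (Real.rpow_pos_of_pos two_pos _),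
    show (2 : ℂ) = ((2 : ℝ) : ℂ) by push_cast; rfl, norm_cpow_eq_rpow_re_of_pos two_pos,
    Real.rpow_right_inj two_pos (by norm_num)] at hn
  exact hn.symm

/-- **ZERO CONFINEMENT FROM THE TWO-STEP TARGET (RH-free).**  If `f₀ = 𝟙_(0,1] - 2^{3/4}𝟙_(0,1/2]`
is an `L²(0,∞)`-limit of real combinations `∑_{k<N} c_k{1/((k+1)x)}` (TARGET(f₀)), then every zero
`s` of `ζ` with `1/2 < Re s < 1` has `Re s = 3/4` and `2^s = 2^{3/4}`.  (RH ⟹ TARGET(f₀) by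
`nbTarget_twoStep_of_rh`; whether TARGET(f₀) ⟹ RH is a discrete-synthesis question — Balazard,
arXiv:1812.04309, Question 2 — plus «ζ ≠ 0 on the lattice», i.e. OPEN.)
[cite: Balazard2020, Prop. 11, Question 2; BaezDuarte2003, Thm. 1.1] -/
theorem zeros_confined_of_nbTarget_twoStep
    (h : ∀ ε : ℝ, 0 < ε → ∃ (N : ℕ) (c : Fin N → ℝ),
      eLpNorm (fun x : ℝ ↦ ((Ioc (0 : ℝ) 1).indicator 1 x -
            (2 : ℝ) ^ ((3 : ℝ) / 4) * (Ioc (0 : ℝ) (1 / 2)).indicator 1 x) -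
          ∑ k : Fin N, c k * Int.fract (1 / (((k : ℕ) + 1 : ℝ) * x))) 2
        (volume.restrict (Ioi 0)) < ENNReal.ofReal ε)
    {s : ℂ} (hζ : riemannZeta s = 0) (hσ : 1 / 2 < s.re) (hσ1 : s.re < 1) :
    s.re = 3 / 4 ∧ (2 : ℂ) ^ s = (2 : ℂ) ^ ((3 : ℂ) / 4) := by
  have hre : 0 < s.re := by linarith
  have hfin1 : (volume.restrict (Ioi (0 : ℝ))) (Ioc 0 1) ≠ ⊤ := by
    rw [Measure.restrict_apply measurableSet_Ioc]
    exact ((measure_mono inter_subset_left).trans_lt measure_Ioc_lt_top).ne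
  have hfin2 : (volume.restrict (Ioi (0 : ℝ))) (Ioc 0 (1 / 2)) ≠ ⊤ := by
    rw [Measure.restrict_apply measurableSet_Ioc]
    exact ((measure_mono inter_subset_left).trans_lt measure_Ioc_lt_top).ne
  have hmel := mellin_eq_zero_of_nbTarget
    (f := fun x ↦ (Ioc (0 : ℝ) 1).indicator 1 x -
      (2 : ℝ) ^ ((3 : ℝ) / 4) * (Ioc (0 : ℝ) (1 / 2)).indicator 1 x)
    ((measurable_one.indicator measurableSet_Ioc).sub
      ((measurable_one.indicator measurableSet_Ioc).const_mul _))
    ((memLp_indicator_const 2 measurableSet_Ioc (1 : ℝ) (Or.inr hfin1)).sub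
      ((memLp_indicator_const 2 measurableSet_Ioc (1 : ℝ) (Or.inr hfin2)).const_mul _))
    (fun x hx ↦ by
      have h1 : x ∉ Ioc (0 : ℝ) 1 := fun h' ↦ absurd h'.2 (not_le.2 hx)
      have h2 : x ∉ Ioc (0 : ℝ) (1 / 2) := fun h' ↦
        absurd (h'.2.trans (by norm_num : (1 / 2 : ℝ) ≤ 1)) (not_le.2 hx)
      simp only [indicator_of_notMem h1, indicator_of_notMem h2, mul_zero, sub_zero])
    h hζ hσ hσ1
  have hmel' : mellin (fun x : ℝ ↦ (((Ioc (0 : ℝ) 1).indicator 1 x -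
      (2 : ℝ) ^ ((3 : ℝ) / 4) * (Ioc (0 : ℝ) (1 / 2)).indicator 1 x : ℝ) : ℂ)) s = 0 := by
    rw [← hmel]
  rw [mellin_twoStep hre] at hmel'
  exact twoStep_mellin_eq_zero hre hmel'

/-- **THE (γ)-SPLITTING: FIN(f₀) ∧ TARGET(f₀) ⟹ RH.**  If `ζ` has no zero at the lattice points
`Re s = 3/4`, `2^s = 2^{3/4}` (FIN(f₀): countably many point conditions, each finite truncation a
known zero computation, the whole RH-implied and open) and the two-step target
`𝟙_(0,1] - 2^{3/4}𝟙_(0,1/2]` is Nyman–Beurling approximable (TARGET(f₀), RH-implied by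
`nbTarget_twoStep_of_rh`), then RH holds.  Both conjuncts are consequences of RH, so the census
verdict is UNDECIDED-BY-CONSTRUCTION (no RH-free refutation of either conjunct exists unless RH is
false); modulo discrete synthesis it is a LOCATION PARTITION of the strip (lattice vs complement).
[cite: Balazard2020, Prop. 10 (i), Prop. 11, Question 2] -/
theorem riemannHypothesis_of_nbTarget_twoStep
    (hfin : ∀ s : ℂ, s.re = 3 / 4 → (2 : ℂ) ^ s = (2 : ℂ) ^ ((3 : ℂ) / 4) → riemannZeta s ≠ 0)
    (h : ∀ ε : ℝ, 0 < ε → ∃ (N : ℕ) (c : Fin N → ℝ),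
      eLpNorm (fun x : ℝ ↦ ((Ioc (0 : ℝ) 1).indicator 1 x -
            (2 : ℝ) ^ ((3 : ℝ) / 4) * (Ioc (0 : ℝ) (1 / 2)).indicator 1 x) -
          ∑ k : Fin N, c k * Int.fract (1 / (((k : ℕ) + 1 : ℝ) * x))) 2
        (volume.restrict (Ioi 0)) < ENNReal.ofReal ε) :
    RiemannHypothesis :=
  quasiRiemannHypothesis_one_half_iff_holds.1 fun s hζ hσ hσ1 ↦ by
    obtain ⟨hre, h2⟩ := zeros_confined_of_nbTarget_twoStep h hζ hσ hσ1
    exact hfin s hre h2 hζ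

/-- **RH ⟹ TARGET(f₀).**  Under RH the two-step target `𝟙_(0,1] - 2^{3/4}𝟙_(0,1/2]`
(`= χ(x) - 2^{3/4}χ(2x)`) is Nyman–Beurling approximable (`nbTarget_twoDilates_of_rh` with
`(a,b,m,m') = (1,-2^{3/4},1,2)`). [cite: BaezDuarte2003, Thm. 1.1; Balazard2020, Prop. 10 (i)] -/
theorem nbTarget_twoStep_of_rh (hRH : RiemannHypothesis) :
    ∀ ε : ℝ, 0 < ε → ∃ (N : ℕ) (c : Fin N → ℝ),
      eLpNorm (fun x : ℝ ↦ ((Ioc (0 : ℝ) 1).indicator 1 x -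
            (2 : ℝ) ^ ((3 : ℝ) / 4) * (Ioc (0 : ℝ) (1 / 2)).indicator 1 x) -
          ∑ k : Fin N, c k * Int.fract (1 / (((k : ℕ) + 1 : ℝ) * x))) 2
        (volume.restrict (Ioi 0)) < ENNReal.ofReal ε := by
  intro ε hε
  obtain ⟨N, c, hN⟩ :=
    nbTarget_twoDilates_of_rh hRH 1 (-(2 : ℝ) ^ ((3 : ℝ) / 4)) (m := 1) (m' := 2) one_pos two_pos ε hε
  refine ⟨N, c, ?_⟩
  have hfun : (fun x : ℝ ↦ ((Ioc (0 : ℝ) 1).indicator 1 x -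
        (2 : ℝ) ^ ((3 : ℝ) / 4) * (Ioc (0 : ℝ) (1 / 2)).indicator 1 x) -
      ∑ k : Fin N, c k * Int.fract (1 / (((k : ℕ) + 1 : ℝ) * x))) =
      fun x : ℝ ↦ (1 * (Ioc (0 : ℝ) 1).indicator 1 (((1 : ℕ) : ℝ) * x) +
        (-(2 : ℝ) ^ ((3 : ℝ) / 4)) * (Ioc (0 : ℝ) 1).indicator 1 (((2 : ℕ) : ℝ) * x)) -
          ∑ k : Fin N, c k * Int.fract (1 / (((k : ℕ) + 1 : ℝ) * x)) := by
    funext x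
    rw [Nat.cast_one, one_mul, one_mul, Nat.cast_ofNat, ← indicator_Ioc_dilate two_pos x, neg_mul,
      ← sub_eq_add_neg]
  rw [hfun]
  exact hN

end Summit.RiemannHypothesis.RiemannHypothesis.Theorems.Splittings.NbTargets
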